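import Mathlib
import HarnessLib
import Literature.MathematicalPhysics.QuantumFieldTheory.ConstructiveQFTWave0
import Summits.Ventures.LatticeQCDFlow.Scaling.TunnellingLaws
import Summits.Ventures.LatticeQCDFlow.Scaling.BoxPeel
import Summits.Ventures.LatticeQCDFlow.Scaling.SliceTwistWitness
import Summits.Ventures.LatticeQCDFlow.Scaling.StripWindingWitness

/-!
# LatticeQCDFlow / Scaling — two-point invariant pairs from a thin witness: no box tunnelling law with a side-uniform threshold (v3.5, (C7b″) for boxes, part 2 of 2)

HONEST FRAMING: exact (Metropolis-corrected) sampling algorithms for lattice gauge theory; figures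
of merit are autocorrelation/cost numbers at stated couplings and volumes; no continuum-physics
claim.

THEORY-2.md §4 (C7), §5.15–5.16.  Sequel of `StripWindingWitness.lean`.

* **§5 (generic two-point pair).**  For ANY configuration `W ≠ 1` that is trivial off an update
  set `Λ`, has all plaquettes within `c' < c` of `1`, and lies outside the `ε`-sector of the trivial
  configuration, the measure `½(δ_1 + δ_W)` and the deterministic swap `1 ↔ W` form an invariant
  Markov pair moving only `Λ`, seeing no `c`-thick plaquette, and changing the `ε`-sector with
  probability one (`exists_invariant_pair_of_witness`); hence no inequality
  `(μ ⊗ κ){sector_ε ≠} ≤ C·μ{∃ p, dist(U_p,1) ≥ c}` holds for `Λ`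
  (`not_thinPlaquetteLaw_of_witness`).
  (`SliceTwistPair.lean` is the instance `W = sliceTwist L`, written out before this file.)
* **§6 (the strip).**  With `W = stripWinding m` (`2 ≤ m`, `m + 2 ≤ L`): no such law for any
  update set `Λ ⊇ stripSupport m` with a threshold `c > π/m`
  (`not_thinPlaquetteLaw_of_stripSupport_subset`).
* **§7 (solid boxes).**  `stripSupport m ⊆ boxLinks 1 l` for `2 ≤ l`, `m ≤ l`, `l + 1 ≤ L`; hence
  for the solid box of side `l` (`2 ≤ l`, `l + 2 ≤ L`) NO law of the shape of
  `Lattice.compProd_sector_ne_le_of_box` (`BoxPatchSectors.lean`: `C = 2`, threshold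
  `ρ/(2·4^{2l-4})`) holds with a threshold `c > π/l`, whatever the constant `C`
  (`not_thinPlaquetteLaw_boxLinks`).  The admissible box threshold therefore lies between
  `≍ 4^{-2l}` (proved sufficient) and `π/l` (proved necessary); for Wilson targets the relevant
  comparison is the winding action `2l(1 - cos(π/l)) ≃ π²/l` [cite: AlbandeaEtAl2021, §3, p.7,
  `⟨ΔS⟩ ≃ βπ²/(2L_w)` for the square winding] — the two-point measures here say nothing about `μ_β`.
-/

noncomputable section

namespace Summit.Ventures.LatticeQCDFlow.Theory2.Lattice.Flux

open MeasureTheory ProbabilityTheory Metric Set Filter Topology Real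
open scoped ENNReal
open Literature.MathematicalPhysics.QuantumFieldTheory Literature.MathematicalPhysics.QuantumLattice

/-! ## §5. The two-point invariant pair of a thin witness -/

section Pair

variable {L : ℕ} [NeZero L]

open Classical in
/-- The two-state swap `1 ↔ W`, the identity elsewhere. [folklore] -/
def swapWith (W U : GaugeConfig 2 L Circle) : GaugeConfig 2 L Circle :=
  if U = 1 then W else if U = W then 1 else U

/-- The swap sends `1` to `W`. [folklore] -/
theorem swapWith_one (W : GaugeConfig 2 L Circle) : swapWith W 1 = W := if_pos rfl

/-- The swap sends `W ≠ 1` to `1`. [folklore] -/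
theorem swapWith_self {W : GaugeConfig 2 L Circle} (hW : W ≠ 1) : swapWith W W = 1 := by
  rw [swapWith, if_neg hW, if_pos rfl]

/-- The swap fixes every other configuration. [folklore] -/
theorem swapWith_of_ne {W U : GaugeConfig 2 L Circle} (h1 : U ≠ 1) (h2 : U ≠ W) :
    swapWith W U = U := by
  rw [swapWith, if_neg h1, if_neg h2]

/-- The swap moves only links where `W` is non-trivial. [folklore] -/
theorem eq_swapWith_of_not_mem {Λ : Set (Edge 2 L)} {W : GaugeConfig 2 L Circle}
    (hoff : ∀ e ∉ Λ, W e = 1) (U : GaugeConfig 2 L Circle) {e : Edge 2 L} (he : e ∉ Λ) :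
    U e = swapWith W U e := by
  by_cases h1 : U = 1
  · subst h1; rw [swapWith_one, hoff e he]; rfl
  · by_cases h2 : U = W
    · subst h2
      by_cases hW : U = 1
      · subst hW; rw [swapWith_one]
      · rw [swapWith_self hW, hoff e he]; rfl
    · rw [swapWith_of_ne h1 h2]

/-- The swap is measurable. [folklore] -/
theorem measurable_swapWith (W : GaugeConfig 2 L Circle) : Measurable (swapWith W) := by
  unfold swapWith
  refine Measurable.ite ?_ measurable_const (Measurable.ite ?_ measurable_const measurable_id)
  · rw [Set.setOf_eq_eq_singleton]; exact measurableSet_singleton _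
  · rw [Set.setOf_eq_eq_singleton]; exact measurableSet_singleton _

/-- The deterministic swap kernel `1 ↔ W`. [folklore] -/
def swapKernelWith (W : GaugeConfig 2 L Circle) :
    Kernel (GaugeConfig 2 L Circle) (GaugeConfig 2 L Circle) :=
  Kernel.deterministic (swapWith W) (measurable_swapWith W)

/-- The swap kernel is Markov. [folklore] -/
instance isMarkovKernel_swapKernelWith (W : GaugeConfig 2 L Circle) :
    IsMarkovKernel (swapKernelWith W) := by
  unfold swapKernelWith; infer_instance

/-- The two-point measure `½(δ_1 + δ_W)`. [folklore] -/
def pairMeasureWith (W : GaugeConfig 2 L Circle) : Measure (GaugeConfig 2 L Circle) :=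
  (2 : ℝ≥0∞)⁻¹ • (Measure.dirac 1 + Measure.dirac W)

/-- The two-point measure is a probability measure. [folklore] -/
instance isProbabilityMeasure_pairMeasureWith (W : GaugeConfig 2 L Circle) :
    IsProbabilityMeasure (pairMeasureWith W) :=
  ⟨by rw [pairMeasureWith, Measure.smul_apply, Measure.add_apply, measure_univ, measure_univ,
    smul_eq_mul, one_add_one_eq_two, ENNReal.inv_mul_cancel two_ne_zero (by simp)]⟩

/-- The swap kernel at the atom `1`. [folklore] -/
theorem swapKernelWith_apply_one (W : GaugeConfig 2 L Circle) :
    swapKernelWith W 1 = Measure.dirac W := by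
  rw [swapKernelWith, Kernel.deterministic_apply, swapWith_one]

/-- The swap kernel at the atom `W`. [folklore] -/
theorem swapKernelWith_apply_self {W : GaugeConfig 2 L Circle} (hW : W ≠ 1) :
    swapKernelWith W W = Measure.dirac 1 := by
  rw [swapKernelWith, Kernel.deterministic_apply, swapWith_self hW]

/-- **Invariance**: the swap exchanges two atoms of equal mass. [folklore] -/
theorem swapKernelWith_invariant {W : GaugeConfig 2 L Circle} (hW : W ≠ 1) :
    (swapKernelWith W).Invariant (pairMeasureWith W) := by
  show (pairMeasureWith W).bind (swapKernelWith W) = pairMeasureWith W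
  ext s hs
  rw [Measure.bind_apply hs (Kernel.measurable _).aemeasurable, pairMeasureWith,
    lintegral_smul_measure, lintegral_add_measure, lintegral_dirac, lintegral_dirac,
    swapKernelWith_apply_one, swapKernelWith_apply_self hW, Measure.smul_apply, Measure.add_apply,
    add_comm]

/-- The swap pair moves only links of `Λ`, almost surely. [folklore] -/
theorem ae_pairWith_eq_off {Λ : Set (Edge 2 L)} {W : GaugeConfig 2 L Circle}
    (hoff : ∀ e ∉ Λ, W e = 1) :
    ∀ᵐ q ∂(pairMeasureWith W ⊗ₘ swapKernelWith W), ∀ e ∉ Λ, q.1 e = q.2 e := by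
  have hRm : MeasurableSet {q : GaugeConfig 2 L Circle × GaugeConfig 2 L Circle |
      ∀ e ∉ Λ, q.1 e = q.2 e} := by
    have hc : IsClosed {q : GaugeConfig 2 L Circle × GaugeConfig 2 L Circle |
        ∀ e ∉ Λ, q.1 e = q.2 e} := by
      simp only [Set.setOf_forall]
      exact isClosed_iInter fun e => isClosed_iInter fun _ =>
        isClosed_eq ((continuous_apply e).comp continuous_fst)
          ((continuous_apply e).comp continuous_snd)
    exact hc.measurableSet
  refine Tunnelling.ae_compProd_of_forall
    (R := fun U U' : GaugeConfig 2 L Circle => ∀ e ∉ Λ, U e = U' e)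
    (pairMeasureWith W) (swapKernelWith W) hRm fun U => ?_
  rw [swapKernelWith, Kernel.deterministic_apply, ae_dirac_eq, Filter.eventually_pure]
  exact fun e he => eq_swapWith_of_not_mem hoff U he

/-- The two-point measure sees no `c`-thick plaquette if `W` has none. [folklore] -/
theorem pairMeasureWith_thick_eq_zero {W : GaugeConfig 2 L Circle} {c : ℝ} (hc0 : 0 < c)
    (hthin : ∀ p : Plaquette 2 L, dist (plaquetteHolonomy W p.1 p.2.1.1 p.2.1.2) 1 < c) :
    pairMeasureWith W {U | ∃ p : Plaquette 2 L,
      c ≤ dist (plaquetteHolonomy U p.1 p.2.1.1 p.2.1.2) 1} = 0 := by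
  have h1 : (1 : GaugeConfig 2 L Circle) ∉ {U : GaugeConfig 2 L Circle | ∃ p : Plaquette 2 L,
      c ≤ dist (plaquetteHolonomy U p.1 p.2.1.1 p.2.1.2) 1} := by
    rintro ⟨p, hp⟩
    rw [plaquetteHolonomy_one', dist_self] at hp
    linarith
  have h2 : W ∉ {U : GaugeConfig 2 L Circle | ∃ p : Plaquette 2 L,
      c ≤ dist (plaquetteHolonomy U p.1 p.2.1.1 p.2.1.2) 1} := by
    rintro ⟨p, hp⟩
    linarith [hthin p]
  rw [pairMeasureWith, Measure.smul_apply, Measure.add_apply, Measure.dirac_apply,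
    Measure.dirac_apply, Set.indicator_of_notMem h1, Set.indicator_of_notMem h2, add_zero,
    smul_zero]

/-- The pair puts full mass on the two ordered atom pairs. [folklore] -/
theorem compProd_pairWith_atoms {W : GaugeConfig 2 L Circle} (hW : W ≠ 1) :
    (pairMeasureWith W ⊗ₘ swapKernelWith W)
      {((1 : GaugeConfig 2 L Circle), W), (W, 1)} = 1 := by
  have hS : MeasurableSet ({((1 : GaugeConfig 2 L Circle), W), (W, 1)} :
        Set (GaugeConfig 2 L Circle × GaugeConfig 2 L Circle)) :=
    (measurableSet_singleton _).insert _
  have hm1 : W ∈ Prod.mk (1 : GaugeConfig 2 L Circle) ⁻¹'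
      ({((1 : GaugeConfig 2 L Circle), W), (W, 1)} :
        Set (GaugeConfig 2 L Circle × GaugeConfig 2 L Circle)) := by simp
  have hm2 : (1 : GaugeConfig 2 L Circle) ∈ Prod.mk W ⁻¹'
      ({((1 : GaugeConfig 2 L Circle), W), (W, 1)} :
        Set (GaugeConfig 2 L Circle × GaugeConfig 2 L Circle)) := by simp
  rw [pairMeasureWith, Measure.compProd_smul_left, Measure.compProd_add_left, Measure.smul_apply,
    Measure.add_apply, Measure.dirac_compProd_apply hS, Measure.dirac_compProd_apply hS,
    swapKernelWith_apply_one, swapKernelWith_apply_self hW, Measure.dirac_apply_of_mem hm1,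
    Measure.dirac_apply_of_mem hm2, smul_eq_mul, one_add_one_eq_two,
    ENNReal.inv_mul_cancel two_ne_zero (by simp)]

/-- **The invariant pair of a thin witness.**  If `W ≠ 1` is trivial off `Λ`, has all plaquettes
within `< c` of `1`, and lies outside the `ε`-sector of `1`, then some `μ`-invariant Markov pair
moves only `Λ`, never sees a `c`-thick plaquette, and changes the `ε`-sector with probability one.
[folklore] -/
theorem exists_invariant_pair_of_witness {Λ : Set (Edge 2 L)} {W : GaugeConfig 2 L Circle}
    (hW : W ≠ 1) (hoff : ∀ e ∉ Λ, W e = 1) {c ε : ℝ} (hc0 : 0 < c)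
    (hthin : ∀ p : Plaquette 2 L, dist (plaquetteHolonomy W p.1 p.2.1.1 p.2.1.2) 1 < c)
    (hsec : connectedComponentIn (Thin L ε) 1 ≠ connectedComponentIn (Thin L ε) W) :
    ∃ (μ : Measure (GaugeConfig 2 L Circle))
      (κ : Kernel (GaugeConfig 2 L Circle) (GaugeConfig 2 L Circle)),
      IsProbabilityMeasure μ ∧ IsMarkovKernel κ ∧ κ.Invariant μ ∧
      (∀ᵐ q ∂(μ ⊗ₘ κ), ∀ e ∉ Λ, q.1 e = q.2 e) ∧
      μ {U | ∃ p : Plaquette 2 L, c ≤ dist (plaquetteHolonomy U p.1 p.2.1.1 p.2.1.2) 1} = 0 ∧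
      (μ ⊗ₘ κ) {q | connectedComponentIn
            {W : GaugeConfig 2 L Circle | ∀ p : Plaquette 2 L,
              dist (plaquetteHolonomy W p.1 p.2.1.1 p.2.1.2) 1 < ε} q.1 ≠
          connectedComponentIn
            {W : GaugeConfig 2 L Circle | ∀ p : Plaquette 2 L,
              dist (plaquetteHolonomy W p.1 p.2.1.1 p.2.1.2) 1 < ε} q.2} = 1 := by
  refine ⟨pairMeasureWith W, swapKernelWith W, inferInstance, inferInstance,
    swapKernelWith_invariant hW, ae_pairWith_eq_off hoff, pairMeasureWith_thick_eq_zero hc0 hthin,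
    ?_⟩
  apply le_antisymm prob_le_one
  calc (1 : ℝ≥0∞) = (pairMeasureWith W ⊗ₘ swapKernelWith W)
        {((1 : GaugeConfig 2 L Circle), W), (W, 1)} := (compProd_pairWith_atoms hW).symm
    _ ≤ _ := measure_mono ?_
  intro q hq
  simp only [Set.mem_insert_iff, Set.mem_singleton_iff] at hq
  rcases hq with rfl | rfl
  · exact hsec
  · exact hsec.symm

/-- **No thin-plaquette law above the witness's plaquette size.**  Under the hypotheses of
`exists_invariant_pair_of_witness`, for ANY constant `C` the inequality
`(μ ⊗ κ){ε-sector changes} ≤ C · μ{∃ p, dist(U_p, 1) ≥ c}` fails for some `μ`-invariant Markov pair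
moving only `Λ`. [folklore] -/
theorem not_thinPlaquetteLaw_of_witness {Λ : Set (Edge 2 L)} {W : GaugeConfig 2 L Circle}
    (hW : W ≠ 1) (hoff : ∀ e ∉ Λ, W e = 1) {c ε : ℝ} (hc0 : 0 < c)
    (hthin : ∀ p : Plaquette 2 L, dist (plaquetteHolonomy W p.1 p.2.1.1 p.2.1.2) 1 < c)
    (hsec : connectedComponentIn (Thin L ε) 1 ≠ connectedComponentIn (Thin L ε) W) (C : ℝ≥0∞) :
    ¬ ∀ (μ : Measure (GaugeConfig 2 L Circle)) [IsProbabilityMeasure μ]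
        (κ : Kernel (GaugeConfig 2 L Circle) (GaugeConfig 2 L Circle)) [IsMarkovKernel κ],
        κ.Invariant μ → (∀ᵐ q ∂(μ ⊗ₘ κ), ∀ e ∉ Λ, q.1 e = q.2 e) →
        (μ ⊗ₘ κ) {q | connectedComponentIn
              {W : GaugeConfig 2 L Circle | ∀ p : Plaquette 2 L,
                dist (plaquetteHolonomy W p.1 p.2.1.1 p.2.1.2) 1 < ε} q.1 ≠
            connectedComponentIn
              {W : GaugeConfig 2 L Circle | ∀ p : Plaquette 2 L,
                dist (plaquetteHolonomy W p.1 p.2.1.1 p.2.1.2) 1 < ε} q.2} ≤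
          C * μ {U | ∃ p : Plaquette 2 L,
            c ≤ dist (plaquetteHolonomy U p.1 p.2.1.1 p.2.1.2) 1} := by
  intro hlaw
  obtain ⟨μ, κ, hμ, hκ, hinv, hmove, hthick, hone⟩ :=
    exists_invariant_pair_of_witness hW hoff hc0 hthin hsec
  haveI := hμ
  haveI := hκ
  have h := hlaw μ κ hinv hmove
  rw [hone, hthick, mul_zero] at h
  exact one_ne_zero (le_zero_iff.mp h)

end Pair

/-! ## §6. The strip: no law above `π/m` for any update set containing the block's links -/

section Strip

variable {L : ℕ} [NeZero L] {m : ℕ}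

/-- **Threshold necessity for update sets containing a `2 × m` block** (`2 ≤ m`, `m + 2 ≤ L`):
for `Λ ⊇ stripSupport m`, `c > π/m`, `0 < ε ≤ 2` and any `C`, no law
`(μ ⊗ κ){sector_ε ≠} ≤ C·μ{∃ p, dist(U_p,1) ≥ c}` over `μ`-invariant Markov pairs moving only `Λ`.
[cite: AlbandeaEtAl2021, §3] -/
theorem not_thinPlaquetteLaw_of_stripSupport_subset (hm : 2 ≤ m) (hmL : m + 2 ≤ L)
    {Λ : Set (Edge 2 L)} (hΛ : stripSupport m ⊆ Λ) {c ε : ℝ} (hc : π / m < c) (hε0 : 0 < ε)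
    (hε2 : ε ≤ 2) (C : ℝ≥0∞) :
    ¬ ∀ (μ : Measure (GaugeConfig 2 L Circle)) [IsProbabilityMeasure μ]
        (κ : Kernel (GaugeConfig 2 L Circle) (GaugeConfig 2 L Circle)) [IsMarkovKernel κ],
        κ.Invariant μ → (∀ᵐ q ∂(μ ⊗ₘ κ), ∀ e ∉ Λ, q.1 e = q.2 e) →
        (μ ⊗ₘ κ) {q | connectedComponentIn
              {W : GaugeConfig 2 L Circle | ∀ p : Plaquette 2 L,
                dist (plaquetteHolonomy W p.1 p.2.1.1 p.2.1.2) 1 < ε} q.1 ≠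
            connectedComponentIn
              {W : GaugeConfig 2 L Circle | ∀ p : Plaquette 2 L,
                dist (plaquetteHolonomy W p.1 p.2.1.1 p.2.1.2) 1 < ε} q.2} ≤
          C * μ {U | ∃ p : Plaquette 2 L, c ≤ dist (plaquetteHolonomy U p.1 p.2.1.1 p.2.1.2) 1} :=
  not_thinPlaquetteLaw_of_witness (stripWinding_ne_one hm hmL)
    (fun _ he => stripWinding_eq_one_of_not_mem fun h => he (hΛ h))
    (lt_of_le_of_lt (by positivity) hc)
    (fun p => (dist_plaquetteHolonomy_stripWinding_le hm hmL p).trans_lt hc)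
    (connectedComponentIn_one_ne_stripWinding hm hmL hε0 hε2) C

end Strip

/-! ## §7. Solid boxes: no law of the box shape with a threshold above `π/l` -/

section Box

variable {L : ℕ} [NeZero L] {m : ℕ}

/-- The links of the `2 × m` block lie in the solid box of side `l ≥ max(2, m)` based at `(1,1)`.
[folklore] -/
theorem stripSupport_subset_boxLinks {l : ℕ} (hl2 : 2 ≤ l) (hml : m ≤ l) (hlL : l + 1 ≤ L) :
    stripSupport m ⊆ boxLinks (1 : Site 2 L) l := by
  haveI : Fact (1 < L) := ⟨by omega⟩
  intro e he
  have hv1 : ∀ t : ZMod L, 1 ≤ t.val → (t - 1).val = t.val - 1 := fun t ht => by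
    rw [ZMod.val_sub (by rw [ZMod.val_one]; exact ht), ZMod.val_one]
  have h20 : ((2 : ZMod L) - 1).val = 1 := by
    rw [show (2 : ZMod L) - 1 = 1 by norm_num, ZMod.val_one]
  simp only [stripSupport, Set.mem_setOf_eq] at he
  show (∀ j, coord 1 e.1 j < l) ∧ coord 1 e.1 e.2 + 1 < l
  simp only [coord, Pi.sub_apply, Pi.one_apply]
  rcases he with ⟨h2, h0, h1, hm'⟩ | ⟨h2, h0, h1, hm'⟩
  · refine ⟨fun j => ?_, ?_⟩
    · fin_cases j
      · simp only [Fin.zero_eta, h0, sub_self, ZMod.val_zero]; omega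
      · simp only [Fin.mk_one, hv1 _ h1]; omega
    · rw [h2, h0, sub_self, ZMod.val_zero]; omega
  · refine ⟨fun j => ?_, ?_⟩
    · fin_cases j
      · rcases h0 with h0 | h0
        · simp only [Fin.zero_eta, h0, sub_self, ZMod.val_zero]; omega
        · simp only [Fin.zero_eta, h0, h20]; omega
      · simp only [Fin.mk_one, hv1 _ h1]; omega
    · rw [h2, hv1 _ h1]; omega

/-- **No box tunnelling law with a side-uniform threshold** (`U(1)`, `d = 2`).  For a solid box of
side `l` (`2 ≤ l`, `l + 2 ≤ L`, update set `boxLinks 1 l` = links with both endpoints in the box),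
`c > π/l`, `0 < ε ≤ 2` and ANY constant `C`, the law
`(μ ⊗ κ){sector_ε ≠} ≤ C·μ{∃ p, dist(U_p,1) ≥ c}` fails for some `μ`-invariant Markov pair moving
only the box — compare `Lattice.compProd_sector_ne_le_of_box` (`C = 2`, threshold
`ρ/(2·4^{2l-4})`, `3 ≤ l`): the admissible threshold of the box law must shrink at least like `π/l`.
[cite: AlbandeaEtAl2021, §3] -/
theorem not_thinPlaquetteLaw_boxLinks {l : ℕ} (hl2 : 2 ≤ l) (hlL : l + 2 ≤ L) {c ε : ℝ}
    (hc : π / l < c) (hε0 : 0 < ε) (hε2 : ε ≤ 2) (C : ℝ≥0∞) :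
    ¬ ∀ (μ : Measure (GaugeConfig 2 L Circle)) [IsProbabilityMeasure μ]
        (κ : Kernel (GaugeConfig 2 L Circle) (GaugeConfig 2 L Circle)) [IsMarkovKernel κ],
        κ.Invariant μ → (∀ᵐ q ∂(μ ⊗ₘ κ), ∀ e ∉ boxLinks (1 : Site 2 L) l, q.1 e = q.2 e) →
        (μ ⊗ₘ κ) {q | connectedComponentIn
              {W : GaugeConfig 2 L Circle | ∀ p : Plaquette 2 L,
                dist (plaquetteHolonomy W p.1 p.2.1.1 p.2.1.2) 1 < ε} q.1 ≠
            connectedComponentIn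
              {W : GaugeConfig 2 L Circle | ∀ p : Plaquette 2 L,
                dist (plaquetteHolonomy W p.1 p.2.1.1 p.2.1.2) 1 < ε} q.2} ≤
          C * μ {U | ∃ p : Plaquette 2 L, c ≤ dist (plaquetteHolonomy U p.1 p.2.1.1 p.2.1.2) 1} :=
  not_thinPlaquetteLaw_of_stripSupport_subset (m := l) hl2 hlL
    (stripSupport_subset_boxLinks hl2 le_rfl (by omega)) hc hε0 hε2 C

end Box

end Summit.Ventures.LatticeQCDFlow.Theory2.Lattice.Flux
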